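import Literature.RingTheory.CohomologyAnnihilator.StrongGeneratorDescentCore
import HarnessLib

/-!
# Descent of a strong generator from `K ⊗ₖ A` to `A`, modulo descent of the generator

Topic: `Literature/RingTheory/CohomologyAnnihilator`.  The descent input `h_desc` of
`singEqVCa_essFiniteType_of_inputs` ([IyengarTakahashi2014], proof of Theorem 5.4: a strong
generator of `mod (K ⊗ₖ A)` with parameter `d` yields one of `mod A`) is reduced here to the
DESCENT OF FINITELY GENERATED MODULES: if every finitely generated `K ⊗ₖ A`-module restricts
along `A → K ⊗ₖ A`, `a ↦ 1 ⊗ a`, to a member of `Add G₀` for some finitely generated `A`-module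
`G₀` (true for `K/k` algebraic: such a module is defined over a finite subextension `l/k`, and
`((K ⊗ₖ A) ⊗_{l ⊗ₖ A} G_l)|_A ≅ ⊕_{K/l-basis} G_l|_A`; pieces D1/D4 of the chain), then `h_desc`
holds (`strongGenerator_descent_of_generatorDescent`, conclusion VERBATIM the binder `h_desc`).
The field-specific inputs of the core `exists_isSyzygy_inTower_of_descentData`
(`StrongGeneratorDescentCore.lean`) for `B = K ⊗ₖ A` with the `A`-algebra structure
`Algebra.TensorProduct.rightAlgebra` are supplied by the `A`-linear commutativity isomorphism
`A ⊗ₖ K ≃ K ⊗ₖ A` (`exists_linearEquiv_rightAlgebra`): flatness (`flat_rightAlgebra`, from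
`Module.Flat.baseChange`) and an `A`-linear retraction of the unit (`exists_retraction_rightAlgebra`,
a `k`-linear retraction of `k → K` tensored with `A`).

## References

* S. B. Iyengar, R. Takahashi, *Annihilation of cohomology and strong generation of module
  categories*, IMRN 2016; arXiv:1404.1476 — proof of Theorem 5.4. [`IyengarTakahashi2014`]
-/

noncomputable section

open CategoryTheory
open scoped TensorProduct

universe u

namespace Literature.RingTheory.CohomologyAnnihilator

section Field

variable (k K A : Type u) [Field k] [Field K] [Algebra k K] [CommRing A] [Algebra k A]

/-- The commutativity isomorphism `A ⊗ₖ K ≅ K ⊗ₖ A` is `A`-linear for the left action on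
`A ⊗ₖ K` and the `rightAlgebra` action on `K ⊗ₖ A`. [folklore] -/
private theorem exists_linearEquiv_rightAlgebra :
    letI := Algebra.TensorProduct.rightAlgebra (R := k) (A := K) (B := A)
    ∃ e : A ⊗[k] K ≃ₗ[A] K ⊗[k] A, ∀ x : A ⊗[k] K, e x = Algebra.TensorProduct.comm k A K x := by
  letI := Algebra.TensorProduct.rightAlgebra (R := k) (A := K) (B := A)
  let c := Algebra.TensorProduct.comm k A K
  have hlin : ∀ (a : A) (x : A ⊗[k] K), c (a • x) = a • c x := by
    intro a x
    induction x using TensorProduct.induction_on with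
    | zero => rw [smul_zero, map_zero, smul_zero]
    | tmul x y =>
      rw [TensorProduct.smul_tmul', Algebra.TensorProduct.comm_tmul, Algebra.TensorProduct.comm_tmul,
        smul_eq_mul, Algebra.smul_def, Algebra.TensorProduct.right_algebraMap_apply,
        Algebra.TensorProduct.tmul_mul_tmul, one_mul]
    | add x y hx hy => rw [smul_add, map_add, hx, hy, map_add, smul_add]
  let e : A ⊗[k] K ≃ₗ[A] K ⊗[k] A := { c.toLinearEquiv with map_smul' := hlin }
  exact ⟨e, fun x => rfl⟩

/-- `K ⊗ₖ A` is flat over `A` (through `a ↦ 1 ⊗ a`). [folklore] -/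
private theorem flat_rightAlgebra :
    letI := Algebra.TensorProduct.rightAlgebra (R := k) (A := K) (B := A)
    Module.Flat A (K ⊗[k] A) := by
  letI := Algebra.TensorProduct.rightAlgebra (R := k) (A := K) (B := A)
  obtain ⟨e, -⟩ := exists_linearEquiv_rightAlgebra k K A
  exact Module.Flat.of_linearEquiv e.symm

/-- The unit `A → K ⊗ₖ A` has an `A`-linear retraction `ρ` with `ρ 1 = 1` (tensor a `k`-linear
retraction of `k → K` with `A`). [folklore] -/
private theorem exists_retraction_rightAlgebra :
    letI := Algebra.TensorProduct.rightAlgebra (R := k) (A := K) (B := A)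
    ∃ ρ : K ⊗[k] A →ₗ[A] A, ρ 1 = 1 := by
  letI := Algebra.TensorProduct.rightAlgebra (R := k) (A := K) (B := A)
  -- a `k`-linear retraction of `k → K`
  obtain ⟨r, hr⟩ := LinearMap.exists_leftInverse_of_injective (Algebra.linearMap k K)
    (by rw [LinearMap.ker_eq_bot]; exact (algebraMap k K).injective)
  have hr1 : r 1 = 1 := by
    have := LinearMap.congr_fun hr (1 : k)
    simpa using this
  -- `ρ₀ : A ⊗ₖ K → A`, `a ⊗ x ↦ r(x) a`
  let ρ₀ : A ⊗[k] K →ₗ[A] A := (TensorProduct.AlgebraTensorModule.rid k A A).toLinearMap ∘ₗ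
    TensorProduct.AlgebraTensorModule.map LinearMap.id r
  have hρ₀ : ρ₀ 1 = 1 := by
    rw [Algebra.TensorProduct.one_def]
    simp [ρ₀, hr1]
  obtain ⟨e, he⟩ := exists_linearEquiv_rightAlgebra k K A
  refine ⟨ρ₀ ∘ₗ e.symm.toLinearMap, ?_⟩
  have h1 : e 1 = 1 := by rw [he]; exact map_one _
  rw [LinearMap.comp_apply, LinearEquiv.coe_toLinearMap, ← h1, e.symm_apply_apply, hρ₀]

end Field

/-- **`h_desc` from descent of finitely generated modules** (proof of [IyengarTakahashi2014,
Thm. 5.4], last paragraph, adapting Keller–Van den Bergh Prop. 5.1.2 with Lemma 4.8): if every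
finitely generated `K ⊗ₖ A`-module restricts along `a ↦ 1 ⊗ a` into `Add G₀` for some finitely
generated `A`-module `G₀` (`K/k` algebraic, `A` of finite type), then a strong generator of
`mod (K ⊗ₖ A)` with parameter `d` descends to one of `mod A` — the conclusion is VERBATIM the
input `h_desc` of `singEqVCa_essFiniteType_of_inputs` / `singEqVCa_essFiniteType_of_descent`.
Proof: `exists_isSyzygy_inTower_of_descentData` for `A → K ⊗ₖ A` (flat, unit-split), with the
generator hypothesis applied to `G' ⊕ (K ⊗ₖ A)`. [cite: IyengarTakahashi2014, Thm. 5.4 (proof)] -/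
theorem strongGenerator_descent_of_generatorDescent
    (hAdd : ∀ (k K : Type u) [Field k] [Field K] [Algebra k K] [Algebra.IsAlgebraic k K]
      (A : Type u) [CommRing A] [Algebra k A], Algebra.FiniteType k A →
      ∀ (G' : ModuleCat.{u} (K ⊗[k] A)), Module.Finite (K ⊗[k] A) G' →
        ∃ G₀ : ModuleCat.{u} A, Module.Finite A G₀ ∧ IsRetractOfCopower G₀
          ((ModuleCat.restrictScalars.{u}
            (Algebra.TensorProduct.includeRight (R := k) (A := K) (B := A)).toRingHom).obj G')) :
    ∀ (k : Type u) [Field k] (K : Type u) [Field K] [Algebra k K] [IsAlgClosed K]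
      [Algebra.IsAlgebraic k K] (A : Type u) [CommRing A] [Algebra k A], Algebra.FiniteType k A →
      ∀ d : ℕ, (∃ G : ModuleCat.{u} (K ⊗[k] A), Module.Finite (K ⊗[k] A) G ∧ ∃ n : ℕ,
          ∀ M : ModuleCat.{u} (K ⊗[k] A), Module.Finite (K ⊗[k] A) M →
            ∃ K' : ModuleCat.{u} (K ⊗[k] A), IsSyzygy d M K' ∧ InTower G n K') →
        ∃ G : ModuleCat.{u} A, Module.Finite A G ∧ ∃ n : ℕ, ∀ M : ModuleCat.{u} A,
          Module.Finite A M → ∃ K' : ModuleCat.{u} A, IsSyzygy d M K' ∧ InTower G n K' := by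
  intro k _ K _ _ _ _ A _ _ hA d hgen
  obtain ⟨G', hG'fin, n, hgen⟩ := hgen
  letI := Algebra.TensorProduct.rightAlgebra (R := k) (A := K) (B := A)
  haveI : Algebra.FiniteType k A := hA
  haveI : IsNoetherianRing A := Algebra.FiniteType.isNoetherianRing k A
  haveI : IsNoetherianRing (K ⊗[k] A) := Algebra.FiniteType.isNoetherianRing K _
  haveI : Module.Flat A (K ⊗[k] A) := flat_rightAlgebra k K A
  obtain ⟨ρ, hρ⟩ := exists_retraction_rightAlgebra k K A
  haveI := hG'fin
  haveI : Module.Finite (K ⊗[k] A) (ModuleCat.of (K ⊗[k] A) (G' × (K ⊗[k] A))) :=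
    Module.Finite.prod
  obtain ⟨G₀, hG₀fin, hG₀⟩ :=
    hAdd k K A hA (ModuleCat.of (K ⊗[k] A) (G' × (K ⊗[k] A))) inferInstance
  haveI := hG₀fin
  exact ⟨G₀, hG₀fin, n + 1, exists_isSyzygy_inTower_of_descentData A (K ⊗[k] A) ρ hρ hgen hG₀⟩

end Literature.RingTheory.CohomologyAnnihilator

end
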